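import Summits.KontsevichZagierPeriods.Zeta5Search.TwoTaleP15Slice
import Summits.KontsevichZagierPeriods.Zeta5Search.Denom.WindowHarmonic

/-!
# The window `13n < p ≤ 26n+1` of the second tale at P15's partner, I: exact decomposition and weights

HONEST FRAMING: systematic search; no irrationality claim unless certified.  Cell `pub-zeta5`,
DENOMINATOR ARITHMETIC lane, THEOREM W of `families/denom/P15KERNEL.md` §10.9 (the window
`(15n, 17n]` of `TopWindowT`, where [Zudilin 2014, Prop. 3] and the termwise bound give only
`ord_p p̂_n ≥ −2`).  Pure `p`-adic bookkeeping of the rational numbers `p̂_n = formPT (aT n) (bT n)`;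
nothing about irrationality.

Fix `n ≥ 1`, an odd prime `p = 2h+1` with `13n < p ≤ 26n+1`, `t_k = p/2 − k`, the index ranges
`I_B = [13n+1, 26n+1]` (simple poles), `I_A = [15n+1, 24n+1]`, and the TOP SET
`T = {k ∈ I_B : m_k = 2k − 26n − 2 ≥ p} = [h + 13n + 2, 26n + 1]` (`topSet`).  With `A_k = coefAT`,
`B_k = coefBT`, `S_{1,2} = harmAlt{1,2}`:
* (E) `signT_mul_formPT_eq` + `sum_top_slice`: summing P1's `slice_identity` over `k ∈ T` and
  exchanging the order of summation,
  `sgn·p̂_n = U/2 − Across/2 − (Σ_j B_j V_j)/2 + Arem + Σ_j B_j W_j`, where `U = Σ_{k∈T} R̂(t_k)`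
  (`Utop`), `W_j = S₁(m_j) − [j∈T]/p` (`Wwt`), `V_j = Σ_{k∈T, k≠j} 1/(t_k+j)` (`Vwt`), and `Across`,
  `Arem` are `p`-integral (`A_k ∈ ℤ_p` for every prime);
* (W), (V) `weight_modP`: modulo `p`, `W_j − V_j/2 ≡ −(H(h) + κ_j)/2` with
  `κ_j = H(j − 13n − 1) − H(26n + 1 − j)` (`kap`) — the `T`-dependent harmonic pieces of `W_j` and
  `V_j/2` CANCEL (both are `(T_j − …)/2` with the same `T_j`);
* (X) `padicNorm_window_weights_le_one`: since `‖B_j‖_p ≤ p` (tree: `padicNorm_coefBT_le`,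
  `EZ_nonneg`) and `Σ_j B_j = 0` (tree: `sum_coefBT_eq_zero`, eq. (T4)), the key lemma of
  `WindowModP` gives `‖sgn·p̂_n − U/2 + (Σ_j B_j κ_j)/2‖_p ≤ 1`.
The gap sum `Σ_j B_j κ_j` and `U` are treated in `TwoTaleP15WindowGap` / `TwoTaleP15TopWindowHolds`.
-/

noncomputable section

namespace Summit.KontsevichZagierPeriods.Zeta5Search.Denom.TwoTaleP15Window

open Finset Polynomial
open Literature.NumberTheory.Irrationality.Zudilin2014
open Summit.KontsevichZagierPeriods.Zeta5Search.TwoTaleP15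
open Summit.KontsevichZagierPeriods.Zeta5Search.Denom.WindowModP
open Summit.KontsevichZagierPeriods.Zeta5Search.Denom.WindowHarmonic

variable {n : ℕ} {p : ℕ} [hp : Fact p.Prime] {h : ℕ}

/-- `‖2‖_p = 1` for odd `p` (file-local copy; the public statement is the tree's
`SecondOrder.padicNorm_two` — kept private here to avoid a `dedup.landed` twin; lane edit lead/lit g13). -/
private theorem padicNorm_two_eq_one (h2 : p ≠ 2) : padicNorm p (2 : ℚ) = 1 := by
  simpa using padicNorm.padicNorm_of_prime_of_ne (p := p) (q := 2) h2

/-! ### The objects -/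

/-- The top set `T = [h + 13n + 2, 26n + 1]`: the indices `k ∈ I_B` with `m_k = 2k − 26n − 2 ≥ p = 2h+1`. -/
def topSet (n h : ℕ) : Finset ℤ := Ico ((h : ℤ) + 13 * (n : ℤ) + 2) (26 * (n : ℤ) + 2)

/-- `U = Σ_{k∈T} R̂(t_k)`, `t_k = p/2 − k`. -/
def Utop (n p h : ℕ) : ℚ := ∑ k ∈ topSet n h, RT (aT n) (bT n) ((p : ℚ) / 2 - k)

/-- The weight `W_j = S₁(m_j) − [j ∈ T]/p` (the `ℓ = p` term of the alternating sum removed). -/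
def Wwt (n p h : ℕ) (j : ℤ) : ℚ :=
  harmAlt1 (2 * j - (26 * (n : ℤ) + 2)).toNat - if j ∈ topSet n h then 1 / (p : ℚ) else 0

/-- The cross weight `V_j = Σ_{k∈T, k≠j} 1/(t_k + j)`. -/
def Vwt (n p h : ℕ) (j : ℤ) : ℚ := ∑ k ∈ (topSet n h).erase j, 1 / ((p : ℚ) / 2 - k + j)

/-- `κ_j = H(j − 13n − 1) − H(26n + 1 − j)`. -/
def kap (n : ℕ) (j : ℤ) : ℚ := HI (j - (13 * (n : ℤ) + 1)) - HI (26 * (n : ℤ) + 1 - j)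

/-- `Across = Σ_{k∈T} Σ_{j∈I_A, j≠k} A_j/(t_k+j)²` (a `p`-integral cross term). -/
def Across (n p h : ℕ) : ℚ :=
  ∑ k ∈ topSet n h, ∑ j ∈ (Ico (15 * (n : ℤ) + 1) (24 * (n : ℤ) + 2)).erase k,
    coefAT (aT n) (bT n) j / ((p : ℚ) / 2 - k + j) ^ 2

/-- `Arem = Σ_{k∈I_B} 2A_k (S₂(m_k) − [k∈T]/p²)` (a `p`-integral remainder). -/
def Arem (n p h : ℕ) : ℚ :=
  ∑ k ∈ Ico (13 * (n : ℤ) + 1) (26 * (n : ℤ) + 2), 2 * coefAT (aT n) (bT n) k *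
    (harmAlt2 (2 * k - (26 * (n : ℤ) + 2)).toNat - if k ∈ topSet n h then 1 / (p : ℚ) ^ 2 else 0)

omit hp in
/-- Membership in the top set. -/
theorem mem_topSet {k : ℤ} : k ∈ topSet n h ↔ (h : ℤ) + 13 * n + 2 ≤ k ∧ k < 26 * (n : ℤ) + 2 := by
  simp [topSet, mem_Ico]

omit hp in
/-- `T ⊆ I_B`. -/
theorem topSet_subset : topSet n h ⊆ Ico (13 * (n : ℤ) + 1) (26 * (n : ℤ) + 2) :=
  Ico_subset_Ico (by omega) le_rfl

/-! ### `A_k ∈ ℤ_p` for every prime, `‖B_k‖_p ≤ p` -/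

/-- `‖A_k‖_p ≤ 1` for every prime `p` and `13n+1 ≤ k ≤ 26n+1` (`A_k` is an integer, eq. (T2)). -/
theorem padicNorm_coefAT_le_one' (hn : 1 ≤ n) {k : ℤ} (hk1 : 13 * (n : ℤ) + 1 ≤ k)
    (hk2 : k ≤ 26 * (n : ℤ) + 1) : padicNorm p (coefAT (aT n) (bT n) k) ≤ 1 := by
  rcases le_or_gt k (15 * (n : ℤ)) with h1 | h1
  · rw [coefAT_eq_zero_of_simple_partner hk1 hk2 (Or.inl h1), padicNorm.zero]; exact zero_le_one
  rcases le_or_gt k (16 * (n : ℤ)) with h2 | h2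
  · rw [coefAT_zoneB1 (by omega) h2, padicNorm.zero]; exact zero_le_one
  rcases le_or_gt k (24 * (n : ℤ) + 1) with h3 | h3
  · refine (padicNorm_coefAT_le hn (by omega) h3).trans ?_
    exact zpow_le_one_of_nonpos₀ (by exact_mod_cast hp.out.one_lt.le)
      (by linarith [EZ_nonneg hp.out.pos n k])
  · rw [coefAT_eq_zero_of_simple_partner hk1 hk2 (Or.inr (by omega)), padicNorm.zero]
    exact zero_le_one

/-- `‖B_k‖_p ≤ p` for `13n < p` (so `26n < p²`) and `13n+1 ≤ k ≤ 26n+1` (eq. (T3a): `ord_p B_k ≥ −1`). -/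
theorem padicNorm_coefBT_le_p (hn : 1 ≤ n) (hp13 : 13 * n < p) {k : ℤ} (hk1 : 13 * (n : ℤ) + 1 ≤ k)
    (hk2 : k ≤ 26 * (n : ℤ) + 1) : padicNorm p (coefBT (aT n) (bT n) k) ≤ p := by
  have hp2 : 26 * n < p ^ 2 := by nlinarith [hp.out.two_le]
  refine (padicNorm_coefBT_le hn hp2 hk1 hk2).trans ?_
  have hp1 : (1 : ℚ) ≤ p := by exact_mod_cast hp.out.one_lt.le
  calc (p : ℚ) ^ (1 - EZ p n k) ≤ (p : ℚ) ^ (1 : ℤ) :=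
        zpow_le_zpow_right₀ hp1 (by linarith [EZ_nonneg hp.out.pos n k])
    _ = p := zpow_one _

/-! ### (E) The exact decomposition -/

omit hp in
/-- `sgn² = 1`. -/
theorem signT_mul_self (b : Fin 4 → ℤ) : signT b * signT b = 1 := by
  unfold signT; rw [← pow_add, ← two_mul]; exact Even.neg_one_pow ⟨_, two_mul _⟩

/-- (E1) `sgn·p̂_n = Σ_{k∈T} (2A_k + pB_k)/p² + Arem + Σ_{j∈I_B} B_j W_j`. -/
theorem signT_mul_formPT_eq (hn : 1 ≤ n) :
    signT (bT n) * formPT (aT n) (bT n)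
      = (∑ k ∈ topSet n h, (2 * coefAT (aT n) (bT n) k + p * coefBT (aT n) (bT n) k) / (p : ℚ) ^ 2)
        + Arem n p h
        + ∑ j ∈ Ico (13 * (n : ℤ) + 1) (26 * (n : ℤ) + 2), coefBT (aT n) (bT n) j * Wwt n p h j := by
  classical
  have hp0 : (p : ℚ) ≠ 0 := by exact_mod_cast hp.out.ne_zero
  obtain ⟨hA3, hB2⟩ := range_eq n
  obtain ⟨hMid, hMax, h0s⟩ := rangeB_eq n
  unfold formPT
  rw [← mul_assoc, signT_mul_self, one_mul, hA3, hB2, hMid, hMax, h0s]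
  have hsub : Ico (15 * (n : ℤ) + 1) (24 * (n : ℤ) + 2) ⊆ Ico (13 * (n : ℤ) + 1) (26 * (n : ℤ) + 2) :=
    Ico_subset_Ico (by omega) (by omega)
  have hzero : ∀ k ∈ Ico (13 * (n : ℤ) + 1) (26 * (n : ℤ) + 2),
      k ∉ Ico (15 * (n : ℤ) + 1) (24 * (n : ℤ) + 2) →
      2 * coefAT (aT n) (bT n) k * harmAlt2 (2 * k - (26 * (n : ℤ) + 2)).toNat = 0 := by
    intro k hk hk'
    simp only [mem_Ico, not_and, not_lt] at hk hk'
    rw [coefAT_eq_zero_of_simple_partner hk.1 (by omega) (by omega), mul_zero, zero_mul]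
  rw [sum_subset hsub hzero, ← sum_add_distrib]
  -- the top sum as a sum over `I_B` with an indicator
  have htop : (∑ k ∈ topSet n h, (2 * coefAT (aT n) (bT n) k + p * coefBT (aT n) (bT n) k) / (p : ℚ) ^ 2)
      = ∑ k ∈ Ico (13 * (n : ℤ) + 1) (26 * (n : ℤ) + 2),
          if k ∈ topSet n h then (2 * coefAT (aT n) (bT n) k + p * coefBT (aT n) (bT n) k) / (p : ℚ) ^ 2
          else 0 := by
    rw [sum_ite_mem, inter_eq_right.2 topSet_subset]
  rw [htop]
  unfold Arem
  rw [← sum_add_distrib, ← sum_add_distrib]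
  refine sum_congr rfl fun k _ => ?_
  unfold Wwt
  by_cases hk : k ∈ topSet n h
  · simp only [hk, if_true]
    field_simp
    ring
  · simp only [hk, if_false, sub_zero, zero_add]

omit hp in
/-- Exchange of summation: `Σ_{k∈T} Σ_{j∈I_B, j≠k} B_j/(t_k+j) = Σ_{j∈I_B} B_j V_j`. -/
theorem sum_top_cross_eq :
    ∑ k ∈ topSet n h, ∑ j ∈ (Ico (13 * (n : ℤ) + 1) (26 * (n : ℤ) + 2)).erase k,
        coefBT (aT n) (bT n) j / ((p : ℚ) / 2 - k + j)
      = ∑ j ∈ Ico (13 * (n : ℤ) + 1) (26 * (n : ℤ) + 2), coefBT (aT n) (bT n) j * Vwt n p h j := by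
  rw [sum_comm' (t' := Ico (13 * (n : ℤ) + 1) (26 * (n : ℤ) + 2)) (s' := fun j => (topSet n h).erase j)]
  · refine sum_congr rfl fun j _ => ?_
    unfold Vwt
    rw [mul_sum]
    refine sum_congr rfl fun k _ => ?_
    rw [mul_one_div]
  · intro k j
    simp only [mem_erase]
    constructor
    · rintro ⟨hk, hjk, hj⟩; exact ⟨⟨fun e => hjk e.symm, hk⟩, hj⟩
    · rintro ⟨⟨hkj, hk⟩, hj⟩; exact ⟨hk, fun e => hkj e.symm, hj⟩

/-- (E2) The slice identity summed over the top set: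
`Σ_{k∈T} (2A_k + pB_k)/p² = U/2 − Across/2 − (Σ_j B_j V_j)/2`. -/
theorem sum_top_slice (hn : 1 ≤ n) (hph : p = 2 * h + 1) (hp13 : 13 * n < p) :
    (∑ k ∈ topSet n h, (2 * coefAT (aT n) (bT n) k + p * coefBT (aT n) (bT n) k) / (p : ℚ) ^ 2)
      = Utop n p h / 2 - Across n p h / 2
        - (∑ j ∈ Ico (13 * (n : ℤ) + 1) (26 * (n : ℤ) + 2), coefBT (aT n) (bT n) j * Vwt n p h j) / 2 := by
  have h2 : p ≠ 2 := by omega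
  have hslice : ∀ k ∈ topSet n h,
      (2 * coefAT (aT n) (bT n) k + p * coefBT (aT n) (bT n) k) / (p : ℚ) ^ 2
        = (RT (aT n) (bT n) ((p : ℚ) / 2 - k)
          - ∑ j ∈ (Ico (15 * (n : ℤ) + 1) (24 * (n : ℤ) + 2)).erase k,
              coefAT (aT n) (bT n) j / ((p : ℚ) / 2 - k + j) ^ 2
          - ∑ j ∈ (Ico (13 * (n : ℤ) + 1) (26 * (n : ℤ) + 2)).erase k,
              coefBT (aT n) (bT n) j / ((p : ℚ) / 2 - k + j)) / 2 := by
    intro k hk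
    rw [mem_topSet] at hk
    rw [← slice_identity hn h2 (by omega) (by omega)]; ring
  rw [sum_congr rfl hslice, ← sum_div, sum_sub_distrib, sum_sub_distrib, sum_top_cross_eq]
  unfold Utop Across
  ring

/-- `Across` is `p`-integral. -/
theorem padicNorm_Across_le_one (hn : 1 ≤ n) (hp13 : 13 * n < p) : padicNorm p (Across n p h) ≤ 1 := by
  have h2 : p ≠ 2 := by omega
  unfold Across
  refine padicNorm.sum_le' (fun k hk => padicNorm.sum_le' (fun j hj => ?_) zero_le_one) zero_le_one
  rw [mem_topSet] at hk
  have hjk := ne_of_mem_erase hj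
  have hj' := mem_of_mem_erase hj
  simp only [mem_Ico] at hj'
  rw [padicNorm.div, sq, padicNorm.mul, padicNorm_tk_add_eq_one h2 hjk (by omega), mul_one, div_one]
  exact padicNorm_coefAT_le_one' hn (by omega) (by omega)

/-- `Arem` is `p`-integral (the `ℓ = p` slice of `S₂` removed on the top set). -/
theorem padicNorm_Arem_le_one (hn : 1 ≤ n) (hph : p = 2 * h + 1) (hp13 : 13 * n < p) :
    padicNorm p (Arem n p h) ≤ 1 := by
  have h2 : p ≠ 2 := by omega
  have h2le : padicNorm p (2 : ℚ) ≤ 1 := by have := padicNorm.of_int (p := p) 2; simpa using this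
  unfold Arem
  refine padicNorm.sum_le' (fun k hk => ?_) zero_le_one
  rw [mem_Ico] at hk
  rw [padicNorm.mul, padicNorm.mul]
  refine mul_le_one₀ (mul_le_one₀ h2le (padicNorm.nonneg _) (padicNorm_coefAT_le_one' hn hk.1 (by omega)))
    (padicNorm.nonneg _) ?_
  by_cases hkT : k ∈ topSet n h
  · rw [mem_topSet] at hkT
    simp only [show k ∈ topSet n h from mem_topSet.2 hkT, if_true]
    exact padicNorm_harmAlt2_sub_le h2 (by omega) (by omega)
  · have hkT' := hkT
    rw [mem_topSet] at hkT'
    simp only [hkT, if_false, sub_zero]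
    exact padicNorm_harmAlt2_le_one (by omega)

/-! ### (W), (V) The weights modulo `p` -/

/-- The `T`-dependent harmonic piece common to `W_j` and `V_j/2`. -/
def Tfun (n h : ℕ) (j : ℤ) : ℚ :=
  if j < (h : ℤ) + 13 * n + 2 then HI ((h : ℤ) + 13 * n + 1 - j) else HI (j - ((h : ℤ) + 13 * n + 2))

/-- (W) `W_j ≡ (T_j − H(h) − H(j − 13n − 1))/2 (mod p)` for `j ∈ I_B` (`13n < p`). -/
theorem Wwt_modP (hph : p = 2 * h + 1) (hp13 : 13 * n < p) {j : ℤ} (hj1 : 13 * (n : ℤ) + 1 ≤ j)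
    (hj2 : j ≤ 26 * (n : ℤ) + 1) :
    EqModP p (Wwt n p h j) ((Tfun n h j - HI h - HI (j - (13 * (n : ℤ) + 1))) / 2) := by
  set u : ℕ := (j - (13 * (n : ℤ) + 1)).toNat with hu
  have hu' : ((u : ℕ) : ℤ) = j - (13 * (n : ℤ) + 1) := Int.toNat_of_nonneg (by omega)
  have hm : (2 * j - (26 * (n : ℤ) + 2)).toNat = 2 * u := by omega
  unfold Wwt Tfun
  rw [hm]
  by_cases hjT : j < (h : ℤ) + 13 * n + 2
  · have hnot : j ∉ topSet n h := fun hh => by rw [mem_topSet] at hh; omega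
    simp only [hnot, if_false, sub_zero, hjT, if_true]
    have h1 := harmAlt1_modP_of_le hph (u := u) (by omega)
    refine h1.congr rfl ?_
    rw [show (h : ℤ) - u = (h : ℤ) + 13 * n + 1 - j by omega, hu']
  · have hmem : j ∈ topSet n h := mem_topSet.2 ⟨by omega, by omega⟩
    simp only [hmem, if_true, hjT, if_false]
    have h1 := harmAlt1_sub_modP_of_lt hph (u := u) (by omega) (by omega)
    refine h1.congr rfl ?_
    rw [show (u : ℤ) - h - 1 = j - ((h : ℤ) + 13 * n + 2) by omega, hu']

/-- (V) `V_j ≡ T_j − H(26n + 1 − j) (mod p)` for `j ∈ I_B` (`13n < p ≤ 26n+1`, so `T ⊆ I_B`):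
`1/(t_k + j) = 2/(p + 2(j−k)) ≡ 1/(j−k)`, then the interval sums are differences of `H`. -/
theorem Vwt_modP (hph : p = 2 * h + 1) (hp13 : 13 * n < p) (hp26 : p ≤ 26 * n + 1) {j : ℤ}
    (hj1 : 13 * (n : ℤ) + 1 ≤ j) (hj2 : j ≤ 26 * (n : ℤ) + 1) :
    EqModP p (Vwt n p h j) (Tfun n h j - HI (26 * (n : ℤ) + 1 - j)) := by
  have h2 : p ≠ 2 := by omega
  have hp0 : (p : ℚ) ≠ 0 := by exact_mod_cast hp.out.ne_zero
  have step1 : EqModP p (Vwt n p h j) (∑ k ∈ (topSet n h).erase j, 1 / ((j : ℚ) - k)) := by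
    unfold Vwt
    refine EqModP.sum fun k hk => ?_
    have hjk := ne_of_mem_erase hk
    have hk' := mem_of_mem_erase hk
    rw [mem_topSet] at hk'
    have h1 := two_div_p_add_modP (p := p) h2 (d := j - k) (sub_ne_zero.2 hjk.symm) (by omega)
    refine h1.congr ?_ ?_
    · have hne : (p : ℚ) / 2 - k + j ≠ 0 := tk_add_ne_zero h2 k j
      push_cast
      field_simp
      ring
    · push_cast; rfl
  refine step1.trans (EqModP.congr (EqModP.refl _) rfl ?_)
  unfold Tfun topSet
  rw [show (26 * (n : ℤ) + 2) = (26 * (n : ℤ) + 1) + 1 by ring]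
  by_cases hjT : j < (h : ℤ) + 13 * n + 2
  · simp only [hjT, if_true]
    rw [erase_eq_of_notMem (by simp [mem_Ico]; omega),
      sum_inv_sub_of_lt hjT (by omega)]
    congr 2; ring
  · simp only [hjT, if_false]
    rw [sum_inv_sub_erase (by omega) hj2]

/-- (W) − (V)/2: the `T`-dependent pieces cancel, `W_j − V_j/2 ≡ −(H(h) + κ_j)/2 (mod p)`. -/
theorem weight_modP (hph : p = 2 * h + 1) (hp13 : 13 * n < p) (hp26 : p ≤ 26 * n + 1) {j : ℤ}
    (hj1 : 13 * (n : ℤ) + 1 ≤ j) (hj2 : j ≤ 26 * (n : ℤ) + 1) :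
    EqModP p (Wwt n p h j - Vwt n p h j / 2) (-(HI h + kap n j) / 2) := by
  have h2 : p ≠ 2 := by omega
  have hW := Wwt_modP hph hp13 hj1 hj2
  have hV := (Vwt_modP hph hp13 hp26 hj1 hj2).div_two h2
  refine (hW.sub hV).congr rfl ?_
  unfold kap; ring

/-! ### (X) Exchange of weights under `Σ_j B_j ·` -/

/-- **(E)+(W)+(V)+(X)**: for `n ≥ 1` and an odd prime `p = 2h+1` with `13n < p ≤ 26n+1`,
`‖sgn·p̂_n − U/2 + (Σ_{j∈I_B} B_j κ_j)/2‖_p ≤ 1`. -/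
theorem padicNorm_window_weights_le_one (hn : 1 ≤ n) (hph : p = 2 * h + 1) (hp13 : 13 * n < p)
    (hp26 : p ≤ 26 * n + 1) :
    padicNorm p (signT (bT n) * formPT (aT n) (bT n) - Utop n p h / 2
      + (∑ j ∈ Ico (13 * (n : ℤ) + 1) (26 * (n : ℤ) + 2), coefBT (aT n) (bT n) j * kap n j) / 2) ≤ 1 := by
  have h2 : p ≠ 2 := by omega
  obtain ⟨hMid, hMax, -⟩ := rangeB_eq n
  have hsumB : ∑ j ∈ Ico (13 * (n : ℤ) + 1) (26 * (n : ℤ) + 2), coefBT (aT n) (bT n) j = 0 := by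
    have := sum_coefBT_eq_zero (admissibleT hn); rwa [hMid, hMax] at this
  -- the key lemma with `w_j = W_j − V_j/2`, `w'_j = −(H(h) + κ_j)/2`
  have hK := padicNorm_sum_mul_sub_le_one (p := p) (s := Ico (13 * (n : ℤ) + 1) (26 * (n : ℤ) + 2))
    (B := fun j => coefBT (aT n) (bT n) j) (w := fun j => Wwt n p h j - Vwt n p h j / 2)
    (w' := fun j => -(HI h + kap n j) / 2)
    (fun j hj => by rw [mem_Ico] at hj; exact padicNorm_coefBT_le_p hn hp13 hj.1 (by omega))
    (fun j hj => by rw [mem_Ico] at hj; exact weight_modP hph hp13 hp26 hj.1 (by omega))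
  have hw' : ∑ j ∈ Ico (13 * (n : ℤ) + 1) (26 * (n : ℤ) + 2), coefBT (aT n) (bT n) j * (-(HI h + kap n j) / 2)
      = -(∑ j ∈ Ico (13 * (n : ℤ) + 1) (26 * (n : ℤ) + 2), coefBT (aT n) (bT n) j * kap n j) / 2 := by
    have e : ∀ j : ℤ, coefBT (aT n) (bT n) j * (-(HI h + kap n j) / 2)
        = -(HI (h : ℤ) / 2) * coefBT (aT n) (bT n) j + -(coefBT (aT n) (bT n) j * kap n j) / 2 :=
      fun j => by ring
    simp_rw [e]
    rw [sum_add_distrib, ← mul_sum, hsumB, mul_zero, zero_add, ← sum_div, sum_neg_distrib]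
  have hw : ∑ j ∈ Ico (13 * (n : ℤ) + 1) (26 * (n : ℤ) + 2), coefBT (aT n) (bT n) j * (Wwt n p h j - Vwt n p h j / 2)
      = signT (bT n) * formPT (aT n) (bT n) - Utop n p h / 2 + Across n p h / 2 - Arem n p h := by
    rw [signT_mul_formPT_eq (p := p) (h := h) hn, sum_top_slice hn hph hp13]
    have e : ∀ j : ℤ, coefBT (aT n) (bT n) j * (Wwt n p h j - Vwt n p h j / 2)
        = coefBT (aT n) (bT n) j * Wwt n p h j - (coefBT (aT n) (bT n) j * Vwt n p h j) / 2 :=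
      fun j => by ring
    simp_rw [e]
    rw [sum_sub_distrib, ← sum_div]
    ring
  rw [hw, hw'] at hK
  have hA := padicNorm_Across_le_one (h := h) hn hp13
  have hR := padicNorm_Arem_le_one hn hph hp13
  have hA2 : padicNorm p (Across n p h / 2) ≤ 1 := by
    rw [padicNorm.div, padicNorm_two_eq_one h2, div_one]; exact hA
  have e : signT (bT n) * formPT (aT n) (bT n) - Utop n p h / 2
      + (∑ j ∈ Ico (13 * (n : ℤ) + 1) (26 * (n : ℤ) + 2), coefBT (aT n) (bT n) j * kap n j) / 2
      = (signT (bT n) * formPT (aT n) (bT n) - Utop n p h / 2 + Across n p h / 2 - Arem n p h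
          - -(∑ j ∈ Ico (13 * (n : ℤ) + 1) (26 * (n : ℤ) + 2), coefBT (aT n) (bT n) j * kap n j) / 2)
        - Across n p h / 2 + Arem n p h := by ring
  rw [e]
  exact padicNorm.nonarchimedean.trans (max_le (padicNorm.sub.trans (max_le hK hA2)) hR)

end Summit.KontsevichZagierPeriods.Zeta5Search.Denom.TwoTaleP15Window

end
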